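import Mathlib
import HarnessLib
import Summits.HubbardSuperconductivity.HubbardSuperconductivity.Theorems.KLProgrammeKLRegimeCountertermJacksonRemainderCertFrameHistC4Core
import Summits.HubbardSuperconductivity.HubbardSuperconductivity.Theorems.KLProgrammeKLRegimeCountertermJacksonRemainderCertNoRateDefs

/-!
# Route `KLProgramme`, crux K3 — gen-8 ENGINE-FLOW child (stmt-HubbardSuperconductivity-20437 `KLRegimeEngineV17F2`), stub (C)
# `stub_twoLeg_curvature`: the (C1) certificate consumers for a `C⁴` HISTORY (no fifth jet), frame-quantified — rate `k ≤ 3`, no-rate `k ≤ 4`, value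

Seat hubbard-kl-k3c3-p1 (g8; row «δμ-flow with klAngularMean constant piece»).  From the frame-quantified named numerical hypothesis
`CutoffDefectCertFrame d A T` (`…CertFrameDefs`, p559400; tables of record `klC1TableF128r/256/512/2048` unchanged), frame sizes
`‖Dʲ(evalM K′)‖ ≤ A j`, the on-curve identity, the regularity of `u_{K′}` and a `C⁴` profile `ν_n(K_n)` with mean-free sizes `a l` (`l ≤ 4`) —
exactly what stub (C)'s induction hypothesis `TwoLegReadJetBound … K_n n` provides (c4a-1 (I2); k3c3-p3 `C1-JETBOX-DEEP.md` §4.2):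

* **`flowPiece_reading_remainder_jets_of_certFrame_rate`** — `1 ≤ k ≤ 3`: `|∂ᵏJ(θ)| ≤ T.bound a k` (mean-value rate row `a_{k+1}·Td`, `k+1 ≤ 4`);
* **`flowPiece_reading_remainder_jets_of_certFrame_noRate`** — `1 ≤ k ≤ 4`: `|∂ᵏJ(θ)| ≤ T.boundNR a k` (`…CertNoRateDefs`: the top increment
  charged by `2·a_k`; k3c3-p3's share `(2 + N0 + Tu₄)/16 ≈ 0.125` of the next bar at `k = 4`);
* **`flowPiece_reading_remainder_value_of_certFrame`** — `k = 0`: `|J(θ)| ≤ a₁·Td + a₀·N0` (FRAME form; the value consumer of record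
  p558812 is keyed by the radius-box certificate only);
here `J(θ) = ν_n(K_n)(θ) − (klFlowPiece n).eval (k_F^{K′} θ)`, every base angle `θ` (periodic reduction `jacksonObject_iteratedDeriv_eq_rep`).
All via `flowPiece_reading_remainder_jets_of_majorants_top` (`…CertFrameHistC4Core`).

Pure assembly; no definitions; nothing here asserts superconductivity.
-/

noncomputable section

namespace Summit.HubbardSuperconductivity.HubbardSuperconductivity.Theorems.KLRegimeSplit

set_option linter.dupNamespace false -- summit = problem name (single-conjunct summit), D-0017

open Real MeasureTheory Filter Set
open scoped Topology
open Literature.Analysis.Fourier.TrigApprox Literature.MathematicalPhysics.QuantumLattice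
open Summit.HubbardSuperconductivity.HubbardSuperconductivity.Theorems.PerturbedFermiCurve

section Frame

variable {L M : ℕ} [NeZero L] [NeZero M]

/-- Periodic reduction of the base angle: the `k`-th jet of the (periodic) Jackson-remainder object at `θ` equals the one at the
representative `θ₀ ∈ [−π, π]`. -/
theorem jacksonObject_iteratedDeriv_eq_rep (β U μ : ℝ) (n : ℕ) (K' : TrigPolyC4v) (k : ℕ) (θ : ℝ) :
    ∃ θ₀ ∈ Set.Icc (-π) π,
      iteratedDeriv k (fun θ => klLocalPart L M β U μ (klFlowFrameU L M β U μ n) n θ -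
          (klFlowPiece L M β U μ n).eval (klFermiPoint μ K' θ)) θ =
        iteratedDeriv k (fun θ => klLocalPart L M β U μ (klFlowFrameU L M β U μ n) n θ -
          (klFlowPiece L M β U μ n).eval (klFermiPoint μ K' θ)) θ₀ := by
  set J : ℝ → ℝ := fun θ => klLocalPart L M β U μ (klFlowFrameU L M β U μ n) n θ - (klFlowPiece L M β U μ n).eval (klFermiPoint μ K' θ)
    with hJ
  have hJper : Function.Periodic J (2 * π) := fun x => by
    simp only [hJ, klLocalPart_periodic β U μ _ n x, klFermiPoint_add_two_pi]
  set θ₀ := toIocMod Real.two_pi_pos (-π) θ with hθ₀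
  obtain ⟨mz, hm⟩ : ∃ m : ℤ, θ = θ₀ + m • (2 * π) :=
    ⟨toIocDiv Real.two_pi_pos (-π) θ, (toIocMod_add_toIocDiv_zsmul Real.two_pi_pos (-π) θ).symm⟩
  have hθ₀mem : θ₀ ∈ Set.Icc (-π) π := by
    have h := toIocMod_mem_Ioc Real.two_pi_pos (-π) θ
    exact ⟨h.1.le, by linarith [h.2]⟩
  refine ⟨θ₀, hθ₀mem, ?_⟩
  rw [hm]; exact (iteratedDeriv_periodic hJper k).zsmul mz θ₀

/-- **THE (C1) CERTIFICATE CONSUMER, FRAME-QUANTIFIED, `C⁴` HISTORY — RATE rows** (`1 ≤ k ≤ 3`, every base angle): the top increment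
charged by the mean-value rate `a_{k+1}·Td` (`k + 1 ≤ 4`): `|∂ᵏJ(θ)| ≤ T.bound a k`. -/
theorem flowPiece_reading_remainder_jets_of_certFrame_rate {d : ℕ} {A : ℕ → ℝ} {T : CutoffDefectTable}
    (hcert : CutoffDefectCertFrame d A T) (β U : ℝ) {μ : ℝ} (hμ : μ ∈ klWindowC) (n : ℕ) (hd : klFlowDeg n = d) (K' : TrigPolyC4v)
    (hA : ∀ j ≤ 4, ∀ p : EuclideanSpace ℝ (Fin 2), ‖iteratedFDeriv ℝ j (fun q : EuclideanSpace ℝ (Fin 2) => K'.eval (WithLp.ofLp q)) p‖ ≤ A j)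
    (hr : ContDiff ℝ 4 (perturbedFermiRadius (fun p => -K'.eval p) μ))
    (hcurve : ∀ ϑ : ℝ, freeBandFn (klFermiPoint μ K' ϑ) - μ = K'.eval (klFermiPoint μ K' ϑ))
    (hf : ContDiff ℝ 4 fun θ : ℝ => klLocalPart L M β U μ (klFlowFrameU L M β U μ n) n θ)
    (hon : ∀ θ, klFrameExtFn μ (fun θ => klLocalPart L M β U μ (klFlowFrameU L M β U μ n) n θ) (klFermiPoint μ K' θ) =
      klLocalPart L M β U μ (klFlowFrameU L M β U μ n) n θ)
    (hang : ∀ θ, klLocalPart L M β U μ (klFlowFrameU L M β U μ n) n (polarAngle (centredRep (klFermiPoint μ K' θ))) =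
      klLocalPart L M β U μ (klFlowFrameU L M β U μ n) n θ)
    {a : ℕ → ℝ} (ha_nn : ∀ l, 0 ≤ a l)
    (ha0 : ∀ x, |klLocalPart L M β U μ (klFlowFrameU L M β U μ n) n x -
      klAngularMean (fun θ => klLocalPart L M β U μ (klFlowFrameU L M β U μ n) n θ)| ≤ a 0)
    (ha : ∀ l, 1 ≤ l → l ≤ 4 → ∀ x, |iteratedDeriv l (fun x => klLocalPart L M β U μ (klFlowFrameU L M β U μ n) n x -
      klAngularMean (fun θ => klLocalPart L M β U μ (klFlowFrameU L M β U μ n) n θ)) x| ≤ a l)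
    (hflat : ∀ ϑ : ℝ, klFlatCutoffFn μ (klFermiPoint μ K' ϑ) = 1)
    {k : ℕ} (hk1 : 1 ≤ k) (hk : k ≤ 3) (θ : ℝ) :
    |iteratedDeriv k (fun θ => klLocalPart L M β U μ (klFlowFrameU L M β U μ n) n θ -
        (klFlowPiece L M β U μ n).eval (klFermiPoint μ K' θ)) θ| ≤ T.bound a k := by
  subst hd
  obtain ⟨θ₀, hθ₀mem, hshift⟩ := jacksonObject_iteratedDeriv_eq_rep (L := L) (M := M) β U μ n K' k θ
  rw [hshift]
  have hk4 : k ≤ 4 := hk.trans (by norm_num)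
  set f : ℝ → ℝ := fun θ => klLocalPart L M β U μ (klFlowFrameU L M β U μ n) n θ with hfdef
  set g : ℝ → ℝ := fun x => f x - klAngularMean f with hgdef
  set r : ℝ → ℝ := perturbedFermiRadius (fun p => -K'.eval p) μ with hrdef
  have hper : Function.Periodic f (2 * Real.pi) := klLocalPart_periodic β U μ _ n
  have hgper : Function.Periodic g (2 * Real.pi) := fun x => by simp only [hgdef, hper x]
  have hg4 : ContDiff ℝ 4 g := hf.sub contDiff_const
  obtain ⟨nq, mq, tq, uq, dq, hin, him, hit, hiu, hid, hae, hN0, hN, hMc, hTt, hTu, hTd⟩ := hcert μ hμ K' hA hr hcurve θ₀ hθ₀mem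
  -- the top increment: mean-value rate `a_{k+1}·|⟨α_w θ₀ − θ₀⟩|`, `k + 1 ≤ 4`
  have hk1' : ((k + 1 : ℕ) : WithTop ℕ∞) ≤ 4 := by exact_mod_cast Nat.succ_le_of_lt (Nat.lt_of_le_of_lt hk (by norm_num))
  have hinc : ∀ᵐ w ∂jmeas, |certCutoff μ r w θ₀| * |iteratedDeriv k g (certAngle r w θ₀) - iteratedDeriv k g θ₀| ≤ a (k + 1) * dq w := by
    refine hae.mono fun w hw => ?_
    have hdq := hw.2.2.2.2.2
    have hmv : |iteratedDeriv k g (certAngle r w θ₀) - iteratedDeriv k g θ₀| ≤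
        a (k + 1) * |toIocMod Real.two_pi_pos (-π) (certAngle r w θ₀ - θ₀)| :=
      abs_iteratedDeriv_sub_le_of_periodic (hg4.of_le hk1') hgper (ha (k + 1) (Nat.le_add_left 1 k) (by omega)) _ _
    calc |certCutoff μ r w θ₀| * |iteratedDeriv k g (certAngle r w θ₀) - iteratedDeriv k g θ₀|
        ≤ |certCutoff μ r w θ₀| * (a (k + 1) * |toIocMod Real.two_pi_pos (-π) (certAngle r w θ₀ - θ₀)|) :=
          mul_le_mul_of_nonneg_left hmv (abs_nonneg _)
      _ = a (k + 1) * (|certCutoff μ r w θ₀| * |toIocMod Real.two_pi_pos (-π) (certAngle r w θ₀ - θ₀)|) := by ring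
      _ ≤ a (k + 1) * dq w := mul_le_mul_of_nonneg_left hdq (ha_nn (k + 1))
  have e : (fun w => jweight (klFlowDeg n) w * (a (k + 1) * dq w)) = fun w => a (k + 1) * (jweight (klFlowDeg n) w * dq w) := by
    funext w; ring
  have hιint : Integrable (fun w => jweight (klFlowDeg n) w * (a (k + 1) * dq w)) jmeas := by
    rw [e]; exact hid.const_mul _
  have hιI : ∫ w, jweight (klFlowDeg n) w * (a (k + 1) * dq w) ∂jmeas ≤ a (k + 1) * T.Td := by
    rw [e, integral_const_mul]
    exact mul_le_mul_of_nonneg_left hTd (ha_nn (k + 1))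
  have h := flowPiece_reading_remainder_jets_of_majorants_top (L := L) (M := M) T β U hμ n K' hf hon hang ha_nn ha0 ha hr hflat hk1 hk4 θ₀
    ⟨nq, mq, tq, uq, dq, hin, him, hit, hiu, hid, hae, hN0, hN, hMc, hTt, hTu, hTd⟩ hιint hιI hinc
  rw [← door_sum_eq_bound T a hk1 hk4]
  exact h

/-- **THE (C1) CERTIFICATE CONSUMER, FRAME-QUANTIFIED, `C⁴` HISTORY — NO-RATE rows** (`1 ≤ k ≤ 4`, every base angle): the top increment
charged by `2·a_k` (`|g⁽ᵏ⁾(α_w θ) − g⁽ᵏ⁾(θ)| ≤ 2a_k`, `0 ≤ χ ≤ 1`, `∫J̃J̃ = 1`): `|∂ᵏJ(θ)| ≤ T.boundNR a k`.  This is the top-order (`k = 4`)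
consumer callable from stub (C)'s induction hypothesis. -/
theorem flowPiece_reading_remainder_jets_of_certFrame_noRate {d : ℕ} {A : ℕ → ℝ} {T : CutoffDefectTable}
    (hcert : CutoffDefectCertFrame d A T) (β U : ℝ) {μ : ℝ} (hμ : μ ∈ klWindowC) (n : ℕ) (hd : klFlowDeg n = d) (K' : TrigPolyC4v)
    (hA : ∀ j ≤ 4, ∀ p : EuclideanSpace ℝ (Fin 2), ‖iteratedFDeriv ℝ j (fun q : EuclideanSpace ℝ (Fin 2) => K'.eval (WithLp.ofLp q)) p‖ ≤ A j)
    (hr : ContDiff ℝ 4 (perturbedFermiRadius (fun p => -K'.eval p) μ))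
    (hcurve : ∀ ϑ : ℝ, freeBandFn (klFermiPoint μ K' ϑ) - μ = K'.eval (klFermiPoint μ K' ϑ))
    (hf : ContDiff ℝ 4 fun θ : ℝ => klLocalPart L M β U μ (klFlowFrameU L M β U μ n) n θ)
    (hon : ∀ θ, klFrameExtFn μ (fun θ => klLocalPart L M β U μ (klFlowFrameU L M β U μ n) n θ) (klFermiPoint μ K' θ) =
      klLocalPart L M β U μ (klFlowFrameU L M β U μ n) n θ)
    (hang : ∀ θ, klLocalPart L M β U μ (klFlowFrameU L M β U μ n) n (polarAngle (centredRep (klFermiPoint μ K' θ))) =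
      klLocalPart L M β U μ (klFlowFrameU L M β U μ n) n θ)
    {a : ℕ → ℝ} (ha_nn : ∀ l, 0 ≤ a l)
    (ha0 : ∀ x, |klLocalPart L M β U μ (klFlowFrameU L M β U μ n) n x -
      klAngularMean (fun θ => klLocalPart L M β U μ (klFlowFrameU L M β U μ n) n θ)| ≤ a 0)
    (ha : ∀ l, 1 ≤ l → l ≤ 4 → ∀ x, |iteratedDeriv l (fun x => klLocalPart L M β U μ (klFlowFrameU L M β U μ n) n x -
      klAngularMean (fun θ => klLocalPart L M β U μ (klFlowFrameU L M β U μ n) n θ)) x| ≤ a l)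
    (hflat : ∀ ϑ : ℝ, klFlatCutoffFn μ (klFermiPoint μ K' ϑ) = 1)
    {k : ℕ} (hk1 : 1 ≤ k) (hk : k ≤ 4) (θ : ℝ) :
    |iteratedDeriv k (fun θ => klLocalPart L M β U μ (klFlowFrameU L M β U μ n) n θ -
        (klFlowPiece L M β U μ n).eval (klFermiPoint μ K' θ)) θ| ≤ T.boundNR a k := by
  subst hd
  obtain ⟨θ₀, hθ₀mem, hshift⟩ := jacksonObject_iteratedDeriv_eq_rep (L := L) (M := M) β U μ n K' k θ
  rw [hshift]
  set f : ℝ → ℝ := fun θ => klLocalPart L M β U μ (klFlowFrameU L M β U μ n) n θ with hfdef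
  set g : ℝ → ℝ := fun x => f x - klAngularMean f with hgdef
  set r : ℝ → ℝ := perturbedFermiRadius (fun p => -K'.eval p) μ with hrdef
  -- the top increment: `|χ_w|·|g⁽ᵏ⁾(α_w θ₀) − g⁽ᵏ⁾(θ₀)| ≤ 1·(a_k + a_k)`
  have hinc : ∀ᵐ w ∂jmeas, |certCutoff μ r w θ₀| * |iteratedDeriv k g (certAngle r w θ₀) - iteratedDeriv k g θ₀| ≤ 2 * a k := by
    refine Filter.Eventually.of_forall fun w => ?_
    have hχ := klFlatCutoffFn_mem_Icc μ (WithLp.ofLp (certCurve r θ₀ - jshift w))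
    have hχ1 : |certCutoff μ r w θ₀| ≤ 1 := by
      rw [certCutoff_apply, abs_of_nonneg hχ.1]; exact hχ.2
    have h1 := ha k hk1 hk (certAngle r w θ₀)
    have h2 := ha k hk1 hk θ₀
    have hsub : |iteratedDeriv k g (certAngle r w θ₀) - iteratedDeriv k g θ₀| ≤ 2 * a k := by
      refine (abs_sub _ _).trans ?_
      linarith
    calc |certCutoff μ r w θ₀| * |iteratedDeriv k g (certAngle r w θ₀) - iteratedDeriv k g θ₀| ≤ 1 * (2 * a k) :=
          mul_le_mul hχ1 hsub (abs_nonneg _) zero_le_one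
      _ = 2 * a k := one_mul _
  have hιint : Integrable (fun w => jweight (klFlowDeg n) w * (2 * a k)) jmeas :=
    (integrable_jmeas_of_continuous (continuous_jweight (klFlowDeg n))).mul_const _
  have hιI : ∫ w, jweight (klFlowDeg n) w * (2 * a k) ∂jmeas ≤ 2 * a k := by
    rw [integral_mul_const, integral_jweight, one_mul]
  have h := flowPiece_reading_remainder_jets_of_majorants_top (L := L) (M := M) T β U hμ n K' hf hon hang ha_nn ha0 ha hr hflat hk1 hk θ₀
    (hcert μ hμ K' hA hr hcurve θ₀ hθ₀mem) hιint hιI hinc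
  rw [← door_sum_eq_boundNR T a hk1 hk]
  exact h

/-- **THE (C1) CERTIFICATE CONSUMER, FRAME-QUANTIFIED, `C⁴` HISTORY — VALUE** (`k = 0`, every base angle; only `a₀, a₁` are read):
`|J(θ)| ≤ a₁·Td + a₀·N0`. -/
theorem flowPiece_reading_remainder_value_of_certFrame {d : ℕ} {A : ℕ → ℝ} {T : CutoffDefectTable}
    (hcert : CutoffDefectCertFrame d A T) (β U : ℝ) {μ : ℝ} (hμ : μ ∈ klWindowC) (n : ℕ) (hd : klFlowDeg n = d) (K' : TrigPolyC4v)
    (hA : ∀ j ≤ 4, ∀ p : EuclideanSpace ℝ (Fin 2), ‖iteratedFDeriv ℝ j (fun q : EuclideanSpace ℝ (Fin 2) => K'.eval (WithLp.ofLp q)) p‖ ≤ A j)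
    (hr : ContDiff ℝ 4 (perturbedFermiRadius (fun p => -K'.eval p) μ))
    (hcurve : ∀ ϑ : ℝ, freeBandFn (klFermiPoint μ K' ϑ) - μ = K'.eval (klFermiPoint μ K' ϑ))
    (hf : ContDiff ℝ 4 fun θ : ℝ => klLocalPart L M β U μ (klFlowFrameU L M β U μ n) n θ)
    (hon : ∀ θ, klFrameExtFn μ (fun θ => klLocalPart L M β U μ (klFlowFrameU L M β U μ n) n θ) (klFermiPoint μ K' θ) =
      klLocalPart L M β U μ (klFlowFrameU L M β U μ n) n θ)
    (hang : ∀ θ, klLocalPart L M β U μ (klFlowFrameU L M β U μ n) n (polarAngle (centredRep (klFermiPoint μ K' θ))) =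
      klLocalPart L M β U μ (klFlowFrameU L M β U μ n) n θ)
    {a : ℕ → ℝ} (ha_nn : ∀ l, 0 ≤ a l)
    (ha0 : ∀ x, |klLocalPart L M β U μ (klFlowFrameU L M β U μ n) n x -
      klAngularMean (fun θ => klLocalPart L M β U μ (klFlowFrameU L M β U μ n) n θ)| ≤ a 0)
    (ha : ∀ l, 1 ≤ l → l ≤ 4 → ∀ x, |iteratedDeriv l (fun x => klLocalPart L M β U μ (klFlowFrameU L M β U μ n) n x -
      klAngularMean (fun θ => klLocalPart L M β U μ (klFlowFrameU L M β U μ n) n θ)) x| ≤ a l)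
    (hflat : ∀ ϑ : ℝ, klFlatCutoffFn μ (klFermiPoint μ K' ϑ) = 1) (θ : ℝ) :
    |klLocalPart L M β U μ (klFlowFrameU L M β U μ n) n θ - (klFlowPiece L M β U μ n).eval (klFermiPoint μ K' θ)| ≤
      a 1 * T.Td + a 0 * T.N0 := by
  subst hd
  obtain ⟨θ₀, hθ₀mem, hshift⟩ := jacksonObject_iteratedDeriv_eq_rep (L := L) (M := M) β U μ n K' 0 θ
  simp only [iteratedDeriv_zero] at hshift
  rw [hshift]
  set f : ℝ → ℝ := fun θ => klLocalPart L M β U μ (klFlowFrameU L M β U μ n) n θ with hfdef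
  set g : ℝ → ℝ := fun x => f x - klAngularMean f with hgdef
  set r : ℝ → ℝ := perturbedFermiRadius (fun p => -K'.eval p) μ with hrdef
  have hper : Function.Periodic f (2 * Real.pi) := klLocalPart_periodic β U μ _ n
  have hgper : Function.Periodic g (2 * Real.pi) := fun x => by simp only [hgdef, hper x]
  have hg4 : ContDiff ℝ 4 g := hf.sub contDiff_const
  have hγ : ContDiff ℝ 4 fun θ => (WithLp.toLp 2 (klFermiPoint μ K' θ) : EuclideanSpace ℝ (Fin 2)) := contDiff_certCurve hr
  obtain ⟨nq, mq, tq, uq, dq, hin, -, -, -, hid, hae, hN0, -, -, -, -, hTd⟩ := hcert μ hμ K' hA hr hcurve θ₀ hθ₀mem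
  have hchain := ae_jmeas_chain_bounds_certAngle_C4 hr hg4 hgper ha θ₀
  -- majorants (no product terms at order 0)
  set pdef : ℕ → ℝ × ℝ → ℝ := fun _ _ => 0 with hpdef
  set tdef : ℝ × ℝ → ℝ := fun w => a 1 * dq w with htdef
  set edef : ℝ × ℝ → ℝ := fun w => a 0 * nq 0 w with hedef
  have hpint : ∀ i, 1 ≤ i → i ≤ 0 → Integrable (fun w => jweight (klFlowDeg n) w * pdef i w) jmeas := fun i hi1 hi0 => by omega
  have et : (fun w => jweight (klFlowDeg n) w * tdef w) = fun w => a 1 * (jweight (klFlowDeg n) w * dq w) := by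
    funext w; simp only [htdef]; ring
  have ee : (fun w => jweight (klFlowDeg n) w * edef w) = fun w => a 0 * (jweight (klFlowDeg n) w * nq 0 w) := by
    funext w; simp only [hedef]; ring
  have htint : Integrable (fun w => jweight (klFlowDeg n) w * tdef w) jmeas := by rw [et]; exact hid.const_mul _
  have heint : Integrable (fun w => jweight (klFlowDeg n) w * edef w) jmeas := by rw [ee]; exact (hin 0).const_mul _
  have hMx : ∀ i, 1 ≤ i → i ≤ 0 → ∫ w, jweight (klFlowDeg n) w * pdef i w ∂jmeas ≤ (0 : ℝ) := fun i hi1 hi0 => by omega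
  have hTm : ∫ w, jweight (klFlowDeg n) w * tdef w ∂jmeas ≤ a 1 * T.Td := by
    rw [et, integral_const_mul]
    exact mul_le_mul_of_nonneg_left hTd (ha_nn 1)
  have hEm : ∫ w, jweight (klFlowDeg n) w * edef w ∂jmeas ≤ a 0 * T.N0 := by
    rw [ee, integral_const_mul]
    exact mul_le_mul_of_nonneg_left hN0 (ha_nn 0)
  have hw : ∀ᵐ w ∂jmeas,
      (∀ i, 1 ≤ i → i ≤ 0 →
        |iteratedDeriv i (fun ϑ : ℝ =>
            klFlatCutoffFn μ (WithLp.ofLp ((WithLp.toLp 2 (klFermiPoint μ K' ϑ) : EuclideanSpace ℝ (Fin 2)) - jshift w))) θ₀| *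
          |iteratedDeriv (0 - i) (fun ϑ : ℝ =>
            f (polarAngle (centredRep (WithLp.ofLp ((WithLp.toLp 2 (klFermiPoint μ K' ϑ) : EuclideanSpace ℝ (Fin 2)) - jshift w)))) -
              klAngularMean f) θ₀| ≤ pdef i w) ∧
      |klFlatCutoffFn μ (WithLp.ofLp ((WithLp.toLp 2 (klFermiPoint μ K' θ₀) : EuclideanSpace ℝ (Fin 2)) - jshift w))| *
        |iteratedDeriv 0 (fun ϑ : ℝ =>
            f (polarAngle (centredRep (WithLp.ofLp ((WithLp.toLp 2 (klFermiPoint μ K' ϑ) : EuclideanSpace ℝ (Fin 2)) - jshift w)))) -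
              klAngularMean f) θ₀ -
          iteratedDeriv 0 (fun ϑ : ℝ => f ϑ - klAngularMean f) θ₀| ≤ tdef w ∧
      |klFlatCutoffFn μ (WithLp.ofLp ((WithLp.toLp 2 (klFermiPoint μ K' θ₀) : EuclideanSpace ℝ (Fin 2)) - jshift w)) - 1| *
        |iteratedDeriv 0 (fun ϑ : ℝ => f ϑ - klAngularMean f) θ₀| ≤ edef w := by
    filter_upwards [hae, hchain] with w h1 h2
    obtain ⟨hnq0, -, -, -, -, hdq⟩ := h1
    have hval := h2.2.2.2.2.2 θ₀
    have ecut0 : klFlatCutoffFn μ (WithLp.ofLp ((WithLp.toLp 2 (klFermiPoint μ K' θ₀) : EuclideanSpace ℝ (Fin 2)) - jshift w)) =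
        certCutoff μ r w θ₀ := rfl
    refine ⟨fun i hi1 hi0 => by omega, ?_, ?_⟩
    · simp only [iteratedDeriv_zero]
      rw [ecut0]
      change |certCutoff μ r w θ₀| * |g (certAngle r w θ₀) - g θ₀| ≤ a 1 * dq w
      calc |certCutoff μ r w θ₀| * |g (certAngle r w θ₀) - g θ₀|
          ≤ |certCutoff μ r w θ₀| * (a 1 * |toIocMod Real.two_pi_pos (-π) (certAngle r w θ₀ - θ₀)|) :=
            mul_le_mul_of_nonneg_left hval (abs_nonneg _)
        _ = a 1 * (|certCutoff μ r w θ₀| * |toIocMod Real.two_pi_pos (-π) (certAngle r w θ₀ - θ₀)|) := by ring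
        _ ≤ a 1 * dq w := mul_le_mul_of_nonneg_left hdq (ha_nn 1)
    · simp only [iteratedDeriv_zero, hedef]
      rw [ecut0]
      calc |certCutoff μ r w θ₀ - 1| * |f θ₀ - klAngularMean f| ≤ nq 0 w * a 0 :=
            mul_le_mul hnq0 (ha0 θ₀) (abs_nonneg _) ((abs_nonneg _).trans hnq0)
        _ = a 0 * nq 0 w := mul_comm _ _
  have hmain := flowPiece_reading_remainder_jets_weightedMoments_ae (L := L) (M := M) β U hμ n K' hf hon hang hγ hflat (k := 0)
    (Nat.zero_le _) θ₀ hpint htint heint hw hMx hTm hEm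
  simpa only [iteratedDeriv_zero, Finset.range_zero, Finset.sum_empty, zero_add] using hmain

end Frame

end Summit.HubbardSuperconductivity.HubbardSuperconductivity.Theorems.KLRegimeSplit

end
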